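import Summits.Ventures.PercRepro.ProfileGapMonoThresholdLongLine

/-!
# PercRepro — THE LONG-LINE CASE OF THE CO-RANK-3 THRESHOLD FAMILY, I: THE SUB-LINE TARGETS
(p5, gen 29; `proofs/P5-GM1.md` §38; announced INBOX 13743)

On a simple coloop-free matroid with `ρ(E) ≥ 3`, a LONG line `ℓ` (`#ℓ + ρ(E) = #E + 1`, i.e. `ν(N) + 1` points) has
a series-class complement `O` (`ProfileGapMonoThresholdLongLine`).  For `y ∈ O` and `D ⊆ ℓ` spanning `ℓ` with
`#D ≤ #ℓ − 1`, the SUB-LINE TARGET `S = D ∪ {y}` has rank `3` (`rk_insert_of_subset_clF`), complement rank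
`≥ ρ(E) − 1` — hence `S ∈ T_t` for every demanding threshold (`insert_mem_levelSetCoQ_three_of_long`) — and `y` as
its only coloop when `#D ≥ 3` (`coloops_insert_subset_of_long`, `mem_coloops_insert_of_subset_clF`), so its slack
`3 − d_t(S)` is at least `2`; a target determines `y` and `D` (`eq_of_insert_eq_of_subset_clF`).  The per-set
excess bound `rk_sdiff_le_card_sdiff_clF_add_ite_long`: `ρ(E∖B) ≤ #(E ∖ cl B) + [cl B long ∧ B ≠ cl B]`.
The counting is in `…LongLineCount`.  Nothing open is asserted.
-/

open scoped Matroid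

namespace PercRepro.Cogirth

open Finset ThmH Skew Shadow Profile

variable {α : Type} [DecidableEq α] {N : Matroid α} [N.Finite]

section Targets

/-- A subset `D` of a rank-`2` flat `cl B` containing two distinct points spans it: `ρ(D) = 2` (simple). -/
theorem rk_eq_two_of_subset_clF (hpair : ∀ x ∈ gr N, ∀ y ∈ gr N, x ≠ y → rk N {x, y} = 2)
    {B D : Finset α} (hB : B ∈ Rq N 2) (hD : D ⊆ clF N B) (hD2 : 2 ≤ D.card) : rk N D = 2 := by
  have hBrk : rk N B = 2 := rk_eq_of_eRk_eq_cq (mem_Rq.1 hB).2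
  have hle : rk N D ≤ 2 := by
    have := rk_mono' (M := N) hD
    rwa [rk_clF, hBrk] at this
  obtain ⟨P, hPD, hP2⟩ := exists_subset_card_eq hD2
  obtain ⟨u, v, huv, rfl⟩ := card_eq_two.1 hP2
  have hu : u ∈ gr N := clF_subset_gr B (hD (hPD (mem_insert_self _ _)))
  have hv : v ∈ gr N := clF_subset_gr B (hD (hPD (mem_insert_of_mem (mem_singleton_self _))))
  have hge : 2 ≤ rk N D := by
    have := rk_mono' (M := N) hPD
    rwa [hpair u hu v hv huv] at this
  omega

/-- `cl D ⊆ cl B` for `D ⊆ cl B`. -/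
theorem clF_subset_clF_of_subset_clF {B D : Finset α} (hB : B ⊆ gr N) (hD : D ⊆ clF N B) :
    clF N D ⊆ clF N B := (clF_mono hD).trans (clF_clF_subset_self B hB)

/-- **A sub-line target has rank `3`**: `ρ(D ∪ {y}) = 3` for `D ⊆ cl B` spanning and `y ∉ cl B`. -/
theorem rk_insert_of_subset_clF (hpair : ∀ x ∈ gr N, ∀ y ∈ gr N, x ≠ y → rk N {x, y} = 2)
    {B D : Finset α} (hB : B ∈ Rq N 2) (hD : D ⊆ clF N B) (hD2 : 2 ≤ D.card) {y : α}
    (hy : y ∈ gr N \ clF N B) : rk N (insert y D) = 3 := by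
  have hBg := (mem_Rq.1 hB).1
  have hDg : D ⊆ gr N := hD.trans (clF_subset_gr B)
  have hycl : y ∉ clF N D := fun h => (mem_sdiff.1 hy).2 (clF_subset_clF_of_subset_clF hBg hD h)
  rw [rk_insert_eq (mem_sdiff.1 hy).1 hDg, if_neg hycl, rk_eq_two_of_subset_clF hpair hB hD hD2]

/-- **The complement of a sub-line target has rank `≥ ρ(E) − 1`** on a long line: it contains `(O ∖ y) ∪ {p}`
for a point `p ∈ ℓ ∖ D`, of rank `ρ(O ∖ y) + 1 = ρ(E) − 1` by the skewness of `O ∖ y` and `ℓ`. -/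
theorem rk_sdiff_insert_of_long (hpair : ∀ x ∈ gr N, ∀ y ∈ gr N, x ≠ y → rk N {x, y} = 2)
    (hcf : ∀ z ∈ gr N, rk N ((gr N).erase z) = rk N (gr N))
    {B : Finset α} (hB : B ∈ Rq N 2) {D : Finset α} (hD : D ⊆ clF N B) {p : α} (hp : p ∈ clF N B)
    (hpD : p ∉ D) {y : α} (hy : y ∈ gr N \ clF N B) : rk N (gr N) ≤ rk N (gr N \ insert y D) + 1 := by
  have hBrk : rk N B = 2 := rk_eq_of_eRk_eq_cq (mem_Rq.1 hB).2
  have hclg : clF N B ⊆ gr N := clF_subset_gr B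
  have hpg : p ∈ gr N := hclg hp
  have hyg : y ∈ gr N := (mem_sdiff.1 hy).1
  have hyp : y ≠ p := fun h => (mem_sdiff.1 hy).2 (h ▸ hp)
  set O := gr N \ clF N B with hO
  -- `(O ∖ y) ∪ {p} ⊆ E ∖ (D ∪ y)`
  have hsub : insert p (O.erase y) ⊆ gr N \ insert y D := by
    intro z hz
    rw [mem_sdiff, mem_insert, not_or]
    rcases mem_insert.1 hz with rfl | hz'
    · exact ⟨hpg, hyp.symm, hpD⟩
    · rw [mem_erase, hO, mem_sdiff] at hz'
      exact ⟨hz'.2.1, hz'.1, fun h => hz'.2.2 (hD h)⟩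
  -- submodularity with `X = insert p (O ∖ y)`, `Y = cl B`
  have hsm := rk_union_add_rk_inter_le (M := N) (insert p (O.erase y)) (clF N B)
  have hU : insert p (O.erase y) ∪ clF N B = clF N B ∪ O.erase y := by
    ext z
    simp only [mem_union, mem_insert]
    constructor
    · rintro ((rfl | h) | h)
      · exact Or.inl hp
      · exact Or.inr h
      · exact Or.inl h
    · rintro (h | h)
      · exact Or.inr h
      · exact Or.inl (Or.inr h)
  have hI : insert p (O.erase y) ∩ clF N B = {p} := by
    ext z
    simp only [mem_inter, mem_insert, mem_singleton]
    constructor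
    · rintro ⟨rfl | h, hz⟩
      · rfl
      · exact absurd hz (mem_sdiff.1 (mem_of_mem_erase h)).2
    · rintro rfl
      exact ⟨Or.inl rfl, hp⟩
  rw [hU, hI, rk_union_erase_of_long_line hcf B hy, rk_clF, hBrk] at hsm
  -- `ρ({p}) = 1`: `ρ({p, y}) = 2 ≤ ρ({p}) + 1`
  have hp1 : 1 ≤ rk N {p} := by
    have h2 := hpair p hpg y hyg hyp.symm
    have h3 : rk N (insert y {p}) ≤ rk N {p} + 1 := rk_insert_le _ _
    rw [pair_comm] at h2
    omega
  have h4 := rk_mono' (M := N) hsub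
  omega

/-- **A sub-line target of a demanding long line lies in `T_t`**: `ρ(D ∪ {y}) = 3` and
`ρ(E ∖ (D ∪ {y})) ≥ ρ(E) − 1 ≥ ρ(E∖B) − 1 ≥ t`. -/
theorem insert_mem_levelSetCoQ_three_of_long (hpair : ∀ x ∈ gr N, ∀ y ∈ gr N, x ≠ y → rk N {x, y} = 2)
    (hcf : ∀ z ∈ gr N, rk N ((gr N).erase z) = rk N (gr N)) {t : ℕ}
    {B : Finset α} (hB : B ∈ Rq N 2) (ht : t + 1 ≤ rk N (gr N \ B)) {D : Finset α} (hD : D ⊆ clF N B)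
    (hD2 : 2 ≤ D.card) {p : α} (hp : p ∈ clF N B) (hpD : p ∉ D) {y : α} (hy : y ∈ gr N \ clF N B) :
    insert y D ∈ levelSetCoQ N t 3 := by
  rw [mem_levelSetCoQ]
  have hDg : D ⊆ gr N := hD.trans (clF_subset_gr B)
  refine ⟨⟨insert_subset (mem_sdiff.1 hy).1 hDg, eRk_eq_of_rk_eq_cq (rk_insert_of_subset_clF hpair hB hD hD2 hy)⟩, ?_⟩
  have h1 := rk_sdiff_insert_of_long hpair hcf hB hD hp hpD hy
  have h2 : rk N (gr N \ B) ≤ rk N (gr N) := rk_mono' sdiff_subset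
  omega

/-- **`y` is a coloop of `D ∪ {y}`** (`ρ(D) = 2 < 3`). -/
theorem mem_coloops_insert_of_subset_clF (hpair : ∀ x ∈ gr N, ∀ y ∈ gr N, x ≠ y → rk N {x, y} = 2)
    {B D : Finset α} (hB : B ∈ Rq N 2) (hD : D ⊆ clF N B) (hD2 : 2 ≤ D.card) {y : α}
    (hy : y ∈ gr N \ clF N B) : y ∈ coloops N (insert y D) := by
  have hDg : D ⊆ gr N := hD.trans (clF_subset_gr B)
  have hyD : y ∉ D := fun h => (mem_sdiff.1 hy).2 (hD h)
  apply mem_coloops_of_rk_erase (insert_subset (mem_sdiff.1 hy).1 hDg) (mem_insert_self _ _)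
  rw [erase_insert hyD, rk_eq_two_of_subset_clF hpair hB hD hD2, rk_insert_of_subset_clF hpair hB hD hD2 hy]

/-- **The coloops of `D ∪ {y}` are among `{y}`** when `#D ≥ 3`: for `z ∈ D`, `ρ((D ∖ z) ∪ {y}) = 3`. -/
theorem coloops_insert_subset_of_long (hpair : ∀ x ∈ gr N, ∀ y ∈ gr N, x ≠ y → rk N {x, y} = 2)
    {B D : Finset α} (hB : B ∈ Rq N 2) (hD : D ⊆ clF N B) (hD3 : 3 ≤ D.card) {y : α}
    (hy : y ∈ gr N \ clF N B) : coloops N (insert y D) ⊆ {y} := by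
  have hDg : D ⊆ gr N := hD.trans (clF_subset_gr B)
  have hyD : y ∉ D := fun h => (mem_sdiff.1 hy).2 (hD h)
  have hyg : y ∈ gr N := (mem_sdiff.1 hy).1
  intro z hz
  rw [mem_coloops] at hz
  obtain ⟨hzS, hzcl⟩ := hz
  rw [mem_singleton]
  by_contra hzy
  have hzD : z ∈ D := by
    rcases mem_insert.1 hzS with h | h
    · exact absurd h hzy
    · exact h
  have hzg : z ∈ gr N := hDg hzD
  have herase : (insert y D).erase z = insert y (D.erase z) := by
    ext w
    simp only [mem_erase, mem_insert]
    constructor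
    · rintro ⟨hwz, h | h⟩
      · exact Or.inl h
      · exact Or.inr ⟨hwz, h⟩
    · rintro (h | ⟨hwz, h⟩)
      · refine ⟨fun hwz => hzy ?_, Or.inl h⟩
        rw [h] at hwz
        exact hwz.symm
      · exact ⟨hwz, Or.inr h⟩
  have hDz : D.erase z ⊆ clF N B := (erase_subset _ _).trans hD
  have hDz2 : 2 ≤ (D.erase z).card := by rw [card_erase_of_mem hzD]; omega
  have h3 : rk N ((insert y D).erase z) = 3 := by
    rw [herase]
    exact rk_insert_of_subset_clF hpair hB hDz hDz2 hy
  apply hzcl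
  rw [mem_clF_iff_rk_insert hzg ((erase_subset _ _).trans (insert_subset hyg hDg)), insert_erase hzS, h3,
    rk_insert_of_subset_clF hpair hB hD (by omega) hy]

/-- **A sub-line target determines its point and its set**: `D ∪ {y} = D' ∪ {y'}` (both with `#D, #D' ≥ 3`) forces
`y = y'` (the unique coloop) and `D = D'`. -/
theorem eq_of_insert_eq_of_subset_clF (hpair : ∀ x ∈ gr N, ∀ y ∈ gr N, x ≠ y → rk N {x, y} = 2)
    {B B' D D' : Finset α} (hB : B ∈ Rq N 2) (hB' : B' ∈ Rq N 2) (hD : D ⊆ clF N B) (hD' : D' ⊆ clF N B')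
    (hD3 : 3 ≤ D.card) (hD3' : 3 ≤ D'.card) {y y' : α} (hy : y ∈ gr N \ clF N B)
    (hy' : y' ∈ gr N \ clF N B') (heq : insert y D = insert y' D') : y = y' ∧ D = D' := by
  have hc : coloops N (insert y D) = {y} :=
    Subset.antisymm (coloops_insert_subset_of_long hpair hB hD hD3 hy)
      (singleton_subset_iff.2 (mem_coloops_insert_of_subset_clF hpair hB hD (by omega) hy))
  have hc' : coloops N (insert y' D') = {y'} :=
    Subset.antisymm (coloops_insert_subset_of_long hpair hB' hD' hD3' hy')
      (singleton_subset_iff.2 (mem_coloops_insert_of_subset_clF hpair hB' hD' (by omega) hy'))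
  have hyy : y = y' := by
    have := hc
    rw [heq, hc'] at this
    exact (singleton_inj.1 this).symm
  refine ⟨hyy, ?_⟩
  have hyD : y ∉ D := fun h => (mem_sdiff.1 hy).2 (hD h)
  have hyD' : y' ∉ D' := fun h => (mem_sdiff.1 hy').2 (hD' h)
  rw [← erase_insert hyD, ← erase_insert hyD', heq, hyy]

/-- **The per-set excess bound on a coloop-free matroid of rank `≥ 3`**:
`ρ(E∖B) ≤ #(E ∖ cl B) + [cl B is long ∧ B ≠ cl B]` for every rank-`2` set `B`. -/
theorem rk_sdiff_le_card_sdiff_clF_add_ite_long (hcf : ∀ z ∈ gr N, rk N ((gr N).erase z) = rk N (gr N))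
    (hR : 3 ≤ rk N (gr N)) {B : Finset α} (hB : B ∈ Rq N 2) :
    rk N (gr N \ B) ≤ (gr N \ clF N B).card +
      (if (clF N B).card + rk N (gr N) = (gr N).card + 1 ∧ B ≠ clF N B then 1 else 0) := by
  have hBrk : rk N B = 2 := rk_eq_of_eRk_eq_cq (mem_Rq.1 hB).2
  have hclg : clF N B ⊆ gr N := clF_subset_gr B
  have hcard : (gr N \ clF N B).card = (gr N).card - (clF N B).card := card_sdiff_of_subset hclg
  have hcl : (clF N B).card ≤ (gr N).card := card_le_card hclg
  have hle2 := card_clF_add_rk_le hB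
  have hrkE : rk N (gr N \ B) ≤ rk N (gr N) := rk_mono' sdiff_subset
  split_ifs with h
  · omega
  · push Not at h
    by_cases hlong : (clF N B).card + rk N (gr N) = (gr N).card + 1
    · -- `B = cl B`: `ρ(E ∖ B) ≤ #(E ∖ B)`
      have hBcl : B = clF N B := h hlong
      rw [← hBcl]
      exact rk_le_card _
    · rcases lt_or_eq_of_le hle2 with hlt | heq
      · exact rk_sdiff_le_card_sdiff_clF_of_nullity B (by omega)
      · have hF := clF_eq_gr_of_card_add_rk_eq hcf hB heq
        have := rk_clF (M := N) B
        rw [hF, hBrk] at this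
        omega

end Targets

end PercRepro.Cogirth
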